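import Summits.PneNP.PneNP.Theorems.ForcedSplitsSandwichPrep

/-!
# Route ForcedSplits — `Sandwich` (stmt-PneNP-8179)

Calibration glue `CleanExitBound → AccountingLemma → FeigeHypothesis 6 → FlowDefectFloor`. If a polynomial-time `f ⊇ SAT`
had violation mass `< n^{-(c+1)}` eventually along the UP-guided flow, then for `g = f ∧ [no empty clause]`:
`Pr[g(root) ∧ unclean] ≤ Pr[unsat ∧ g(root) ∧ unclean] + Pr[sat] < n^{-(c+1)} + 2ⁿ(7/8)^{6n} ≤ n^{-c}`
(`AccountingLemma`, first moment), so `CleanExitBound` forces `Pr[g(root)] < 1/3`; on the ensemble `g(root) = f(root)`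
(no empty clauses), hence `¬f` is a polynomial-time SOUND refuter accepting with probability `> 2/3 ≥ 1/2` eventually —
contradicting `FeigeHypothesis 6` (`⌈6 n⌉ = 6 n`).
-/

set_option linter.dupNamespace false -- `Summit.PneNP.PneNP.…`: summit = sub-problem name (D-0017 single-conjunct layout)

namespace Summit.PneNP.PneNP.Theorems

open Literature.Computability.Complexity Literature.Computability.MetaComplexity Filter Topology

/-- Doubling a power of `1/n`: `2 · n^{-(c+1)} ≤ n^{-c}` for `n ≥ 2`. [folklore] -/
theorem forcedSplits_two_mul_inv_pow_le {n : ℕ} (hn : 2 ≤ n) (c : ℕ) :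
    2 * ((n : ENNReal)⁻¹) ^ (c + 1) ≤ ((n : ENNReal)⁻¹) ^ c := by
  have hn0 : (n : ENNReal) ≠ 0 := by exact_mod_cast (show n ≠ 0 by omega)
  have h2 : (2 : ENNReal) * (n : ENNReal)⁻¹ ≤ 1 := by
    calc (2 : ENNReal) * (n : ENNReal)⁻¹ ≤ (n : ENNReal) * (n : ENNReal)⁻¹ := by
          gcongr; exact_mod_cast hn
      _ = 1 := ENNReal.mul_inv_cancel hn0 (ENNReal.natCast_ne_top n)
  calc 2 * ((n : ENNReal)⁻¹) ^ (c + 1) = ((n : ENNReal)⁻¹) ^ c * (2 * (n : ENNReal)⁻¹) := by rw [pow_succ]; ring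
    _ ≤ ((n : ENNReal)⁻¹) ^ c * 1 := by gcongr
    _ = ((n : ENNReal)⁻¹) ^ c := mul_one _

/-- `1/2 ≤ 1 - x` whenever `x < 1/3` (in `ℝ≥0∞`). [folklore] -/
theorem forcedSplits_half_le_one_sub {x : ENNReal} (hx : x < 1 / 3) : (1 / 2 : ENNReal) ≤ 1 - x := by
  have h13 : (1 / 3 : ENNReal) = ENNReal.ofReal (1 / 3) := by
    rw [ENNReal.ofReal_div_of_pos (by norm_num : (0 : ℝ) < 3), ENNReal.ofReal_one, ENNReal.ofReal_ofNat]
  have h12 : (1 / 2 : ENNReal) = ENNReal.ofReal (1 / 2) := by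
    rw [ENNReal.ofReal_div_of_pos (by norm_num : (0 : ℝ) < 2), ENNReal.ofReal_one, ENNReal.ofReal_ofNat]
  have hsum : x + 1 / 2 ≤ 1 := by
    calc x + 1 / 2 ≤ 1 / 3 + 1 / 2 := add_le_add hx.le le_rfl
      _ = ENNReal.ofReal (1 / 3 + 1 / 2) := by rw [h13, h12, ENNReal.ofReal_add (by norm_num) (by norm_num)]
      _ ≤ 1 := by rw [← ENNReal.ofReal_one]; exact ENNReal.ofReal_le_ofReal (by norm_num)
  exact ENNReal.le_sub_of_add_le_left (ne_top_of_lt hx) hsum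

/-- **`Sandwich` (stmt-PneNP-8179).** [cite: Feige2002, §1 Hypothesis 1] [folklore] -/
theorem forcedSplits_sandwich_proof : Summit.PneNP.PneNP.Theses.ForcedSplits.Sandwich := by
  classical
  intro hCEB hAL hFH
  unfold Summit.PneNP.PneNP.Theses.ForcedSplits.FlowDefectFloor
  intro restrict step run J nviol f hf hfsat
  set clean : (n : ℕ) → (CNF ℕ → Bool) → CNF ℕ × Equiv.Perm (Fin n) × (Fin n → Bool) → Prop := fun n g ω => ∃ a : ℕ, a < (run n ω).2.length ∧ (∀ t : ℕ, t ≤ (run n ω).2.length → ((((run n ω).2.reverse.map fun r => g r.1) ++ [g (run n ω).1]).getD t false = true ↔ t ≤ a)) ∧ ((run n ω).2.reverse.getD a ([], 0, false, false)).2.2.2 = false ∧ g (restrict ((run n ω).2.reverse.getD a ([], 0, false, false)).1 ((run n ω).2.reverse.getD a ([], 0, false, false)).2.1 (!((run n ω).2.reverse.getD a ([], 0, false, false)).2.2.1)) = true with hclean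
  have hAL' : ∀ (n : ℕ) (g : CNF ℕ → Bool), (∀ ψ : CNF ℕ, ([] : Clause ℕ) ∈ ψ → g ψ = false) →
      (J n).toOuterMeasure {ω | ¬ ω.1.Satisfiable ∧ g ω.1 = true ∧ ¬ clean n g ω} ≤ ∑' ω, J n ω * (nviol n g ω : ENNReal) := hAL
  have hCEB' : ∃ c N : ℕ, ∀ n ≥ N, ∀ g : CNF ℕ → Bool, (∀ ψ : CNF ℕ, ([] : Clause ℕ) ∈ ψ → g ψ = false) →
      (1 / 3 : ENNReal) ≤ (J n).toOuterMeasure {ω | g ω.1 = true} → ((n : ENNReal)⁻¹) ^ c ≤ (J n).toOuterMeasure {ω | g ω.1 = true ∧ ¬ clean n g ω} := hCEB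
  obtain ⟨c, N, hceb⟩ := hCEB'
  have hJ : ∀ n, J n = (randomKCNF 3 n (6 * n)).bind fun φ =>
      (PMF.uniformOfFintype (Equiv.Perm (Fin n) × (Fin n → Bool))).map fun r => (φ, r) := fun n => rfl
  -- the wrapped labelling
  set g : CNF ℕ → Bool := fun ψ => f (Literature.Computability.Complexity.encodingCNF.encode ψ) && decide (([] : Literature.Computability.Complexity.Clause ℕ) ∉ ψ) with hg
  have hg0 : ∀ ψ : CNF ℕ, ([] : Clause ℕ) ∈ ψ → g ψ = false := fun ψ h => by simp [hg, h]
  refine ⟨c + 1, ?_⟩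
  by_contra hnot
  rw [Filter.not_frequently] at hnot
  obtain ⟨N₁, hN₁⟩ := eventually_atTop.1 hnot
  obtain ⟨N₂, hN₂⟩ := eventually_atTop.1 (forcedSplits_decay c)
  -- eventually the root is rarely accepted
  have hsmall : ∀ n, max (max N₁ N₂) (max N 3) ≤ n → (randomKCNF 3 n (6 * n)).toOuterMeasure {φ | f (encodingCNF.encode φ) = true} < 1 / 3 := by
    intro n hn
    have hn1 : N₁ ≤ n := le_trans (le_max_left _ _ |>.trans (le_max_left _ _)) hn
    have hn2 : N₂ ≤ n := le_trans (le_max_right _ _ |>.trans (le_max_left _ _)) hn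
    have hnN : N ≤ n := le_trans (le_max_left _ _ |>.trans (le_max_right _ _)) hn
    have hn3 : 3 ≤ n := le_trans (le_max_right _ _ |>.trans (le_max_right _ _)) hn
    -- the three events
    have h1 : (J n).toOuterMeasure {ω | ¬ ω.1.Satisfiable ∧ g ω.1 = true ∧ ¬ clean n g ω} < ((n : ENNReal)⁻¹) ^ (c + 1) :=
      lt_of_le_of_lt (hAL' n g hg0) (not_le.1 (hN₁ n hn1))
    have h2 : (J n).toOuterMeasure {ω | ω.1.Satisfiable} ≤ ((n : ENNReal)⁻¹) ^ (c + 1) := by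
      rw [hJ, forcedSplits_flow_marginal (randomKCNF 3 n (6 * n)) n fun φ => φ.Satisfiable]
      exact (forcedSplits_prob_satisfiable_le hn3).trans (hN₂ n hn2)
    have h3 : (J n).toOuterMeasure {ω | g ω.1 = true ∧ ¬ clean n g ω} < ((n : ENNReal)⁻¹) ^ c := by
      have hsub : {ω : CNF ℕ × Equiv.Perm (Fin n) × (Fin n → Bool) | g ω.1 = true ∧ ¬ clean n g ω} ⊆
          {ω | ¬ ω.1.Satisfiable ∧ g ω.1 = true ∧ ¬ clean n g ω} ∪ {ω | ω.1.Satisfiable} := by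
        intro ω hω
        by_cases hs : ω.1.Satisfiable
        · exact Or.inr hs
        · exact Or.inl ⟨hs, hω⟩
      calc (J n).toOuterMeasure {ω | g ω.1 = true ∧ ¬ clean n g ω}
          ≤ (J n).toOuterMeasure ({ω | ¬ ω.1.Satisfiable ∧ g ω.1 = true ∧ ¬ clean n g ω} ∪ {ω | ω.1.Satisfiable}) :=
            (J n).toOuterMeasure.mono hsub
        _ ≤ (J n).toOuterMeasure {ω | ¬ ω.1.Satisfiable ∧ g ω.1 = true ∧ ¬ clean n g ω} + (J n).toOuterMeasure {ω | ω.1.Satisfiable} :=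
            MeasureTheory.measure_union_le _ _
        _ < ((n : ENNReal)⁻¹) ^ (c + 1) + ((n : ENNReal)⁻¹) ^ (c + 1) :=
            ENNReal.add_lt_add_of_lt_of_le (ne_top_of_le_ne_top ENNReal.one_ne_top (Literature.Computability.Cryptography.pmf_toOuterMeasure_apply_le_one _ _)) h1 h2
        _ = 2 * ((n : ENNReal)⁻¹) ^ (c + 1) := (two_mul _).symm
        _ ≤ ((n : ENNReal)⁻¹) ^ c := forcedSplits_two_mul_inv_pow_le (by omega) c
    have h4 : (J n).toOuterMeasure {ω | g ω.1 = true} < 1 / 3 := by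
      by_contra h
      exact absurd (hceb n hnN g hg0 (not_lt.1 h)) (not_le.2 h3)
    -- on the ensemble, `g(root) = f(root)`
    rw [hJ, forcedSplits_flow_marginal (randomKCNF 3 n (6 * n)) n fun φ => g φ = true] at h4
    have heq : {φ : CNF ℕ | f (encodingCNF.encode φ) = true} ∩ (randomKCNF 3 n (6 * n)).support =
        {φ : CNF ℕ | g φ = true} ∩ (randomKCNF 3 n (6 * n)).support := by
      ext φ
      simp only [Set.mem_inter_iff, Set.mem_setOf_eq, hg, Bool.and_eq_true, decide_eq_true_eq]
      constructor
      · rintro ⟨h, hs⟩; exact ⟨⟨h, forcedSplits_nil_not_mem_of_support hs⟩, hs⟩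
      · rintro ⟨⟨h, -⟩, hs⟩; exact ⟨h, hs⟩
    rw [← PMF.toOuterMeasure_apply_inter_support, heq, PMF.toOuterMeasure_apply_inter_support]
    exact h4
  -- hence `¬f` is a sound polynomial-time refuter accepting with probability `≥ 1/2` eventually
  refine hFH ⟨fun x => !f x, forcedSplits_isPolyTimePred_not hf, fun φ hφ hsat => ?_, ?_⟩
  · have h := hfsat φ hsat
    have hφ' : (!f (encodingCNF.encode φ)) = true := hφ
    rw [h] at hφ'
    exact Bool.noConfusion hφ'
  · refine eventually_atTop.2 ⟨max (max N₁ N₂) (max N 3), fun n hn => ?_⟩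
    have hceil : randomKCNFAtDensity 3 6 n = randomKCNF 3 n (6 * n) := by
      rw [randomKCNFAtDensity, show (6 : ℝ) * (n : ℝ) = ((6 * n : ℕ) : ℝ) by push_cast; ring, Nat.ceil_natCast]
    have hset : ({φ : CNF ℕ | (!f (encodingCNF.encode φ)) = true} : Set (CNF ℕ)) = {φ | f (encodingCNF.encode φ) = true}ᶜ := by
      ext φ; simp
    rw [hceil, hset, forcedSplits_toOuterMeasure_compl]
    exact forcedSplits_half_le_one_sub (hsmall n hn)

end Summit.PneNP.PneNP.Theorems
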